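import Mathlib.Algebra.Order.BigOperators.Group.Finset
import Mathlib.Algebra.BigOperators.Intervals
import Mathlib.Data.Fin.Basic
import Mathlib.Data.Finset.Card
import Mathlib.Tactic.Linarith
import Mathlib.Tactic.Ring

/-!
# Route «KPlusLogSqLaw», crux `TropicalB` (stmt-ValiantsHypothesis-19771) — the MONGE RANK LAW: a strictly convex cost read through
# `r` «boundary states» forces `r ≥ pq/(p+q−1)`; binary counters need bit-separators of size Ω(K / log K)

HONEST FRAMING.  Helper file toward the registered stubs `stub_tropThin` / `stub_tropFat` of `Cruxes/TropicalB/Lines/birth.lean` (crux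
`Summit.ValiantsHypothesis.ValiantsHypothesis.Theses.KPlusLogSqLaw.TropicalB`, item stmt-ValiantsHypothesis-19771, route KPlusLogSqLaw; cell
`pub-symmetroid`, seat val-sym-trop-p5 g17, refuter-adjacent lane, 2026-08-28; `--supports … --as helper`).  A COMBINATORIAL ENGINE (pure
arithmetic of arrays; no design vocabulary) used by the seat's SEPARATOR LAW for marked-edge binary counters (memo
HOME/val-sym-trop-p5/g17/COUNTER-MECHANISMS-g17.md §3).  It bounds nothing for `TropicalB` in its window and bears on neither `WeakLifting`,
DoorA26 / DoorA34, `MatrixDescartes` (stmt-ValiantsHypothesis-18050) nor VP ≠ VNP.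

THE ENGINE.  An integer array `M : Fin p → Fin q → ℤ` is STRICTLY ANTI-MONGE if `M x y' + M x' y > M x y + M x' y'` whenever `x < x'` and
`y' < y` (stated inline); e.g. `M x y = G (e x + f y)` for strictly increasing `e, f` and a `G` with strictly increasing differences
(`isStrictAntiMonge_of_convex`, the equal-width chord inequality `chord_lt`).  A MIN-PLUS FACTORISATION of `M` through `r` states is a family
`A : Fin r → Fin p → ℤ`, `B : Fin r → Fin q → ℤ` with `M x y ≤ A β x + B β y` always and equality for some `β` at every `(x, y)`.
* `MongeRank.chain_of_active` — for each state `β` the ACTIVE SET `{(x,y) : M x y = A β x + B β y}` is a chain of the product order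
  (no `x < x'` with active `(x, y)`, `(x', y')`, `y' < y`: the two slack inequalities at the crossed positions contradict anti-Monge);
* `MongeRank.card_chain_le` — a chain of `Fin p × Fin q` has at most `p + q − 1` elements (`(x,y) ↦ x + y` is injective on it);
* **`MongeRank.mul_le_of_factorisation` — `p · q ≤ r · (p + q − 1)`**: the `r` active chains cover the whole array.
DESIGN READING (paper, memo §3; the dictionary is val-sym-trop-p4 g14's hull reformulation).  In a full `K`-bit marked-edge binary counter the
optimal pattern cost is a strictly convex function `G` of the binary value (tree: `EqualSteps.valuation_step_lt`, …TropicalBTransferLaw); split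
the bits into `B_P ⊔ B_Q` and index patterns by `(x_P, x_Q)`: the array `G(x_P + x_Q)` (`p = 2^{|B_P|}`, `q = 2^{|B_Q|}`) is strictly anti-Monge.
If a vertex set `S` of the support digraph, disjoint from the bits, separates the bits of `B_P` from those of `B_Q`, then every cover splits
along `S` and the pattern cost is a min-plus product through the `r ≤ (|S|+2)^{2|S|}` boundary states of `S` (which side each vertex of `S` is
entered from and left to); hence `(|S|+2)^{2|S|} ≥ 2^{min(|B_P|,|B_Q|) − 1}`, i.e. **every bit-balanced separator has `|S| = Ω(K / log K)`**:
path-, ring-, necklace-, ladder- and series-gadget architectures of width `w` count at most `O(w log w)` bits, whatever their weights.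
[folklore: Monge arrays / SMAWK total monotonicity; min-plus rank via chain covers]
-/

set_option linter.dupNamespace false
set_option autoImplicit false

namespace Summit.ValiantsHypothesis.ValiantsHypothesis.Theorems.KPlusLogSqLaw

namespace MongeRank

open Finset

/-- **Active sets are chains.**  If `M ≤ A ⊕ B` entrywise (a min-plus upper bound by ONE state) and `M` is strictly anti-Monge, then two
active positions `(x, y)`, `(x', y')` (where equality holds) with `x < x'` have `y ≤ y'`. -/
theorem chain_of_active {p q : ℕ} {M : Fin p → Fin q → ℤ} (hM : (∀ (x x' : Fin p) (y y' : Fin q), x < x' → y' < y → M x y + M x' y' < M x y' + M x' y)) (A : Fin p → ℤ) (B : Fin q → ℤ)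
    (hle : ∀ x y, M x y ≤ A x + B y) {x x' : Fin p} {y y' : Fin q} (hx : x < x')
    (hxy : M x y = A x + B y) (hx'y' : M x' y' = A x' + B y') : y ≤ y' := by
  by_contra h
  have hy : y' < y := lt_of_not_ge h
  have h1 := hle x y'
  have h2 := hle x' y
  have h3 := hM x x' y y' hx hy
  linarith

/-- A chain of the product order on `Fin p × Fin q` (no two members cross) has at most `p + q − 1` elements: `(x, y) ↦ x + y` is
injective on it and takes values below `p + q − 1`. -/
theorem card_chain_le {p q : ℕ} (R : Finset (Fin p × Fin q))
    (hR : ∀ a ∈ R, ∀ b ∈ R, a.1 < b.1 → a.2 ≤ b.2) : R.card ≤ p + q - 1 := by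
  have hinj : Set.InjOn (fun a : Fin p × Fin q => (a.1 : ℕ) + (a.2 : ℕ)) R := by
    intro a ha b hb hab
    simp only at hab
    rcases lt_trichotomy a.1 b.1 with h | h | h
    · have := hR a ha b hb h
      have h' : (a.1 : ℕ) < (b.1 : ℕ) := h
      have h'' : (a.2 : ℕ) ≤ (b.2 : ℕ) := this
      omega
    · have h2 : (a.2 : ℕ) = (b.2 : ℕ) := by have := congrArg Fin.val h; omega
      exact Prod.ext h (Fin.ext h2)
    · have := hR b hb a ha h
      have h' : (b.1 : ℕ) < (a.1 : ℕ) := h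
      have h'' : (b.2 : ℕ) ≤ (a.2 : ℕ) := this
      omega
  have himg : R.image (fun a : Fin p × Fin q => (a.1 : ℕ) + (a.2 : ℕ)) ⊆ Finset.range (p + q - 1) := by
    intro s hs
    rw [Finset.mem_image] at hs
    obtain ⟨a, _, rfl⟩ := hs
    rw [Finset.mem_range]
    have := a.1.isLt; have := a.2.isLt; omega
  calc R.card = (R.image fun a : Fin p × Fin q => (a.1 : ℕ) + (a.2 : ℕ)).card := (Finset.card_image_of_injOn hinj).symm
    _ ≤ (Finset.range (p + q - 1)).card := Finset.card_le_card himg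
    _ = p + q - 1 := Finset.card_range _

/-- **MONGE RANK LAW.**  If a strictly anti-Monge `p × q` array is a min-plus product through `r` states — `M x y ≤ A β x + B β y` for all
`β` with equality for some `β` at every position — then `p · q ≤ r · (p + q − 1)`. -/
theorem mul_le_of_factorisation {p q r : ℕ} {M : Fin p → Fin q → ℤ} (hM : (∀ (x x' : Fin p) (y y' : Fin q), x < x' → y' < y → M x y + M x' y' < M x y' + M x' y))
    (A : Fin r → Fin p → ℤ) (B : Fin r → Fin q → ℤ) (hle : ∀ β x y, M x y ≤ A β x + B β y)
    (hex : ∀ x y, ∃ β, M x y = A β x + B β y) : p * q ≤ r * (p + q - 1) := by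
  classical
  -- active set of each state
  let R : Fin r → Finset (Fin p × Fin q) := fun β => Finset.univ.filter fun a => M a.1 a.2 = A β a.1 + B β a.2
  have hRchain : ∀ β, ∀ a ∈ R β, ∀ b ∈ R β, a.1 < b.1 → a.2 ≤ b.2 := by
    intro β a ha b hb hab
    simp only [R, Finset.mem_filter, Finset.mem_univ, true_and] at ha hb
    exact chain_of_active hM (A β) (B β) (hle β) hab ha hb
  have hcover : (Finset.univ : Finset (Fin p × Fin q)) ⊆ Finset.univ.biUnion R := by
    intro a _
    rw [Finset.mem_biUnion]
    obtain ⟨β, hβ⟩ := hex a.1 a.2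
    exact ⟨β, Finset.mem_univ _, by simp [R, hβ]⟩
  calc p * q = (Finset.univ : Finset (Fin p × Fin q)).card := by simp
    _ ≤ (Finset.univ.biUnion R).card := Finset.card_le_card hcover
    _ ≤ ∑ β, (R β).card := Finset.card_biUnion_le
    _ ≤ ∑ _β : Fin r, (p + q - 1) := Finset.sum_le_sum fun β _ => card_chain_le (R β) (hRchain β)
    _ = r * (p + q - 1) := by simp

/-! ### strictly convex costs give strictly anti-Monge arrays -/

/-- **Equal-width chords of a sequence with strictly increasing differences.**  If `G (t+1) − G t` strictly increases for `t + 1 < N`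
then for `a < c` and a common width `w ≥ 1` with `c + w ≤ N`: `G (a + w) − G a < G (c + w) − G c`. -/
theorem chord_lt (G : ℕ → ℤ) (N : ℕ) (hG : ∀ t, t + 1 < N → G (t + 1) - G t < G (t + 2) - G (t + 1))
    {a c w : ℕ} (hac : a < c) (hw : 1 ≤ w) (hcw : c + w ≤ N) : G (a + w) - G a < G (c + w) - G c := by
  -- increments strictly increase: Δ i < Δ j for i < j, j + 1 ≤ N
  have hmono : ∀ i j, i < j → j + 1 ≤ N → G (i + 1) - G i < G (j + 1) - G j := by
    intro i j hij hj
    induction j with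
    | zero => omega
    | succ j ih =>
      rcases Nat.lt_succ_iff_lt_or_eq.mp hij with h | h
      · have := ih h (by omega)
        have h2 := hG j (by omega)
        have e : j + 2 = j + 1 + 1 := by ring
        rw [e] at h2
        linarith
      · subst h
        have h2 := hG i (by omega)
        have e : i + 2 = i + 1 + 1 := by ring
        rw [e] at h2
        exact h2
  -- telescope over the width
  induction w with
  | zero => omega
  | succ w ih =>
    rcases Nat.eq_zero_or_pos w with hw0 | hwpos
    · subst hw0
      simpa using hmono a c hac (by omega)
    · have h1 := ih (by omega) (by omega)
      have h2 := hmono (a + w) (c + w) (by omega) (by omega)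
      have e1 : a + (w + 1) = a + w + 1 := by ring
      have e2 : c + (w + 1) = c + w + 1 := by ring
      rw [e1, e2]
      linarith

/-- The array `G (e x + f y)` of a sequence `G` with strictly increasing differences (below `N`), read along strictly increasing
`e : Fin p → ℕ`, `f : Fin q → ℕ` with `e x + f y + 1 ≤ N`, is strictly anti-Monge.  (Binary counters: `G` = optimal pattern cost as a
function of the binary value of the OFF-set, `e`, `f` = the values of the OFF-sets of two disjoint groups of bits.) -/
theorem isStrictAntiMonge_of_convex {p q : ℕ} (G : ℕ → ℤ) (N : ℕ)
    (hG : ∀ t, t + 1 < N → G (t + 1) - G t < G (t + 2) - G (t + 1))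
    (e : Fin p → ℕ) (f : Fin q → ℕ) (he : StrictMono e) (hf : StrictMono f) (hN : ∀ x y, e x + f y + 1 ≤ N) :
    ∀ (x x' : Fin p) (y y' : Fin q), x < x' → y' < y →
      G (e x + f y) + G (e x' + f y') < G (e x + f y') + G (e x' + f y) := by
  intro x x' y y' hx hy
  have hex : e x < e x' := he hx
  have hfy : f y' < f y := hf hy
  -- chord from `a = e x + f y'` of width `w = f y − f y'`, shifted to `c = e x' + f y'`
  have key := chord_lt G N hG (a := e x + f y') (c := e x' + f y') (w := f y - f y') (by omega) (by omega)
    (by have := hN x' y; omega)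
  have e1 : e x + f y' + (f y - f y') = e x + f y := by omega
  have e2 : e x' + f y' + (f y - f y') = e x' + f y := by omega
  rw [e1, e2] at key
  linarith

/-- **COROLLARY (binary-counter form).**  If the cost `G` has strictly increasing differences below `N` and, for two groups of
positions read through strictly increasing `e : Fin p → ℕ`, `f : Fin q → ℕ` (`e x + f y + 1 ≤ N`), the values `G (e x + f y)` are a min-plus
product through `r` states, then `p · q ≤ r · (p + q − 1)`; with `p = q = 2^h` this is `r ≥ 2^(h−1)`: the two halves of a `2h`-bit
counter cannot communicate through fewer than `2^(h−1)` boundary states. -/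
theorem mul_le_of_convex_factorisation {p q r : ℕ} (G : ℕ → ℤ) (N : ℕ)
    (hG : ∀ t, t + 1 < N → G (t + 1) - G t < G (t + 2) - G (t + 1))
    (e : Fin p → ℕ) (f : Fin q → ℕ) (he : StrictMono e) (hf : StrictMono f) (hN : ∀ x y, e x + f y + 1 ≤ N)
    (A : Fin r → Fin p → ℤ) (B : Fin r → Fin q → ℤ) (hle : ∀ β x y, G (e x + f y) ≤ A β x + B β y)
    (hex : ∀ x y, ∃ β, G (e x + f y) = A β x + B β y) : p * q ≤ r * (p + q - 1) :=
  mul_le_of_factorisation (M := fun x y => G (e x + f y)) (isStrictAntiMonge_of_convex G N hG e f he hf hN) A B hle hex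

end MongeRank

end Summit.ValiantsHypothesis.ValiantsHypothesis.Theorems.KPlusLogSqLaw
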